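import Summits.Ventures.PercRepro2.CaseOneJ1
import Summits.Ventures.PercRepro2.CaseOneGadgetUWOBMainI

/-!
# `(J1)` for the gadget `u ~ {w, o, b}`, `w ~ {u, a₁, a₂}` (blind cell PercRepro2, p1 g20; CONJECTURES row 2′J1)

The gadget predicate is symmetric under the root swap together with the swap of the two root edges at `w`
(`IsGadgetUWOB.swap`), so the `(J1₁)` theorem `jOneOne_of_gadgetUWOB` (CaseOneGadgetUWOBMainI) and its
mirror add up to **`jOne_of_gadgetUWOB`** (`jOne_of_jOneOne_of_mirror`): `(J1)` at `u` for every finite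
graph, every weight vector, every `u` adjacent exactly to an unmarked `w` and to `o, b`, with `w` adjacent
exactly to `u, a₁, a₂` — the first class with an unmarked neighbour of the statement vertex on `(J1)`.
Own code; standard axioms.
-/

namespace Summit.Ventures.PercRepro2

namespace CaseOne

section Swap
variable {V : Type*} {E : Type*}
variable {ends : E → Sym2 V} {o a₁ a₂ b u w : V} {euw euo eub ewa1 ewa2 : E}

/-- The gadget with the roots swapped (and the two root edges at `w` swapped with them). -/
theorem IsGadgetUWOB.swap (h : IsGadgetUWOB ends o a₁ a₂ b u w euw euo eub ewa1 ewa2) :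
    IsGadgetUWOB ends o a₂ a₁ b u w euw euo eub ewa2 ewa1 where
  ends_uw := h.ends_uw
  ends_uo := h.ends_uo
  ends_ub := h.ends_ub
  ends_wa1 := h.ends_wa2
  ends_wa2 := h.ends_wa1
  ne_uw_uo := h.ne_uw_uo
  ne_uw_ub := h.ne_uw_ub
  ne_uw_wa1 := h.ne_uw_wa2
  ne_uw_wa2 := h.ne_uw_wa1
  ne_uo_ub := h.ne_uo_ub
  ne_uo_wa1 := h.ne_uo_wa2
  ne_uo_wa2 := h.ne_uo_wa1
  ne_ub_wa1 := h.ne_ub_wa2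
  ne_ub_wa2 := h.ne_ub_wa1
  ne_wa1_wa2 := h.ne_wa1_wa2.symm
  unique_u := h.unique_u
  unique_w := fun e he => by
    rcases h.unique_w e he with h' | h' | h'
    · exact Or.inl h'
    · exact Or.inr (Or.inr h')
    · exact Or.inr (Or.inl h')
  ne_wu := h.ne_wu
  ne_ou := h.ne_ou
  ne_bu := h.ne_bu
  ne_a1u := h.ne_a2u
  ne_a2u := h.ne_a1u
  ne_a1w := h.ne_a2w
  ne_a2w := h.ne_a1w
  ne_ow := h.ne_ow
  ne_bw := h.ne_bw

end Swap

section JOne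
variable {V : Type*} {E : Type*} [Fintype E] [DecidableEq E] [Fintype V] [DecidableEq V]
  {R : Type*} [Field R] [LinearOrder R] [IsStrictOrderedRing R]
variable {ends : E → Sym2 V} {o a₁ a₂ b u w : V} {euw euo eub ewa1 ewa2 : E}

/-- **`(J1)` at `u` for the gadget `u ~ {w, o, b}`, `w ~ {u, a₁, a₂}`**, every finite graph, every weight
vector. -/
theorem jOne_of_gadgetUWOB (p : E → R) (hp : IsProbVec p)
    (h : IsGadgetUWOB ends o a₁ a₂ b u w euw euo eub ewa1 ewa2) : JOne p ends o a₁ a₂ u b :=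
  jOne_of_jOneOne_of_mirror p ends o a₁ a₂ u b (jOneOne_of_gadgetUWOB p hp h)
    (jOneOne_of_gadgetUWOB p hp h.swap)

end JOne

end CaseOne

end Summit.Ventures.PercRepro2
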